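import Summits.CriticalPhenomena.PercolationContinuityZ3.Theorems.PercNearOneGluingNoHeavyLowerTailThreePartitionOneOrTwisted
import HarnessLib.Audit

/-!
# `NoHeavyLowerTail` (crux stmt-CriticalPhenomena-4575), master-family hierarchy P3 (gen 37): the SIGNATURE METHOD for an ARBITRARY JUNTA —
# a diagonal Kleitman certificate on the block `Q` gives `threePartNT τ (liftQ Q 𝔘) A B ≥ 0` for ALL up-sets `A, B`

Support file (seat `prim-masterthm-p3`; `--supports stmt-CriticalPhenomena-4575`; memo
`run/shared/lean/prim/prim-masterthm/FROM-prim-masterthm-p3-g37-ONE-DISJUNCTION.md` §8).  The one-disjunction theorem (`…ThreePartitionOneOrTwisted`) is the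
case `𝔘 = {m : m ≠ ∅}` of the following scheme.  Let `𝒰 = liftQ Q 𝔘 = {x : x ∩ Q ∈ 𝔘}` be a JUNTA on the block `Q` (any family `𝔘`).  With the junta pattern
weights `cJ P = [qc₂P ∈ 𝔘] + [qc₃P ∈ 𝔘] − [qc₁P ∈ 𝔘]` and `eJ P = 2[qc₃P ∈ 𝔘] − [qc₁P ∈ 𝔘]`,
  `R = Σ_P cJ(P)·teeRep(qc₂P, qc₃P)`,  `Φ = Σ_P eJ(P)·deeRep(qc₃P)`   (`rPart_liftQ_eq_sum`, `phiPart_liftQ_eq_sum`; any twist).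
A PURE DIAGONAL CERTIFICATE is `κ : Set ι → ℤ`, `κ ≥ 0`, with, for all up-sets `𝔄, 𝔅` (signatures),
  (i)  `Σ_P cJ(P)[qc₂P ∈ 𝔄][qc₃P ∈ 𝔅] ≤ Σ_{m ⊆ Q} κ(m)[m ∈ 𝔄 ∩ 𝔅]`,   (ii) `Σ_{m ⊆ Q} κ(m)[m ∈ 𝔄 ∩ 𝔅] ≤ Σ_P eJ(P)[qc₃P ∈ 𝔄 ∩ 𝔅]`.
THEOREM `threePartNT_liftQ_nonneg_of_cert`: a certificate gives `0 ≤ threePartNT τ (liftQ Q 𝔘) A B` for all up-sets `A, B` — on EVERY ground set `ι ⊇ Q`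
(the chain: (i) pointwise in the traces, Kleitman `teeRep_le_deeRep` termwise since `κ ≥ 0`, (ii) pointwise).  Certificates are finite objects on `2^Q`;
integer certificates for EVERY monotone `𝔘` on `|Q| ≤ 4` and every `τ ∩ Q` were found by LP and verified exactly (memo §8: the 4-JUNTA THEOREM, kernel discharge
of the finite checks pending).  HONEST LABEL: a reduction (certificate ⇒ positivity), kernel-checked; the general conjecture stays OPEN. [this work]
-/

noncomputable section

open Finset
open scoped symmDiff Classical

namespace Summit.CriticalPhenomena.PercolationContinuityZ3.Theorems.ThreePartition

variable {ι : Type*} [Fintype ι]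

section JuntaWeights

variable (τ Q : Set ι) (𝔘 : Set (Set ι))

/-- Junta pattern weight of the two-copy part: `cJ(P) = [qc₂P ∈ 𝔘] + [qc₃P ∈ 𝔘] − [qc₁P ∈ 𝔘]`. [this work] -/
def cJ (P : Set ι × Set ι) : ℤ := indZ (qc₂ τ Q P ∈ 𝔘) + indZ (qc₃ τ Q P ∈ 𝔘) - indZ (qc₁ τ Q P ∈ 𝔘)

/-- Junta pattern weight of the one-copy part: `eJ(P) = 2[qc₃P ∈ 𝔘] − [qc₁P ∈ 𝔘]`. [this work] -/
def eJ (P : Set ι × Set ι) : ℤ := 2 * indZ (qc₃ τ Q P ∈ 𝔘) - indZ (qc₁ τ Q P ∈ 𝔘)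

omit [Fintype ι] in
/-- Gluing a Q-part `m ⊆ Q` onto a trace and testing the junta: `(x \ Q) ∪ m ∈ liftQ Q 𝔘 ↔ m ∈ 𝔘`. [this work] -/
theorem sdiff_union_mem_liftQ_iff {Q : Set ι} (𝔘 : Set (Set ι)) {x m : Set ι} (hm : m ⊆ Q) : x \ Q ∪ m ∈ liftQ Q 𝔘 ↔ m ∈ 𝔘 := by
  rw [mem_liftQ, sdiff_union_inter_eq hm]

/-- **`R = Σ_P cJ(P)·teeRep(qc₂P, qc₃P)`** for a junta first family (any twist). [this work] -/
theorem rPart_liftQ_eq_sum (A B : Set (Set ι)) :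
    rPart τ (liftQ Q 𝔘) A B = ∑ P ∈ cfgsIn Q, cJ τ Q 𝔘 P * teeRep τ Q A B (qc₂ τ Q P) (qc₃ τ Q P) := by
  unfold rPart cJ teeRep
  rw [triT_eq_sum_cfgsIn τ Q (fun _ x₂ x₃ => x₂ ∈ A ∧ x₃ ∈ B ∧ x₃ ∈ liftQ Q 𝔘),
    triT_eq_sum_cfgsIn τ Q (fun _ x₂ x₃ => x₂ ∈ A ∧ x₃ ∈ B ∧ x₂ ∈ liftQ Q 𝔘),
    triT_eq_sum_cfgsIn τ Q (fun x₁ x₂ x₃ => x₂ ∈ A ∧ x₃ ∈ B ∧ x₁ ∈ liftQ Q 𝔘)]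
  push_cast
  rw [← sum_add_distrib, ← sum_sub_distrib]
  refine sum_congr rfl fun P hP => ?_
  rw [mem_cfgsIn] at hP
  have e1 : (triT τ (fun x₁ x₂ x₃ => x₁ ∩ Q = Q \ τ ∧ (x₂ \ Q ∪ qc₂ τ Q P ∈ A ∧ x₃ \ Q ∪ qc₃ τ Q P ∈ B ∧ x₃ \ Q ∪ qc₃ τ Q P ∈ liftQ Q 𝔘)) : ℤ)
      = indZ (qc₃ τ Q P ∈ 𝔘) * triT τ (fun x₁ x₂ x₃ => x₁ ∩ Q = Q \ τ ∧ (x₂ \ Q ∪ qc₂ τ Q P ∈ A ∧ x₃ \ Q ∪ qc₃ τ Q P ∈ B)) := by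
    rw [← triT_and_const]; exact_mod_cast triT_congr fun a b d => by
      rw [sdiff_union_mem_liftQ_iff 𝔘 (x := d) (qc₃_subset τ Q P)]; tauto
  have e2 : (triT τ (fun x₁ x₂ x₃ => x₁ ∩ Q = Q \ τ ∧ (x₂ \ Q ∪ qc₂ τ Q P ∈ A ∧ x₃ \ Q ∪ qc₃ τ Q P ∈ B ∧ x₂ \ Q ∪ qc₂ τ Q P ∈ liftQ Q 𝔘)) : ℤ)
      = indZ (qc₂ τ Q P ∈ 𝔘) * triT τ (fun x₁ x₂ x₃ => x₁ ∩ Q = Q \ τ ∧ (x₂ \ Q ∪ qc₂ τ Q P ∈ A ∧ x₃ \ Q ∪ qc₃ τ Q P ∈ B)) := by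
    rw [← triT_and_const]; exact_mod_cast triT_congr fun a b d => by
      rw [sdiff_union_mem_liftQ_iff 𝔘 (x := b) (qc₂_subset (τ := τ) hP.2.1)]; tauto
  have e3 : (triT τ (fun x₁ x₂ x₃ => x₁ ∩ Q = Q \ τ ∧ (x₂ \ Q ∪ qc₂ τ Q P ∈ A ∧ x₃ \ Q ∪ qc₃ τ Q P ∈ B ∧ x₁ \ Q ∪ qc₁ τ Q P ∈ liftQ Q 𝔘)) : ℤ)
      = indZ (qc₁ τ Q P ∈ 𝔘) * triT τ (fun x₁ x₂ x₃ => x₁ ∩ Q = Q \ τ ∧ (x₂ \ Q ∪ qc₂ τ Q P ∈ A ∧ x₃ \ Q ∪ qc₃ τ Q P ∈ B)) := by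
    rw [← triT_and_const]; exact_mod_cast triT_congr fun a b d => by
      rw [sdiff_union_mem_liftQ_iff 𝔘 (x := a) (qc₁_subset (τ := τ) hP.1)]; tauto
  rw [e1, e2, e3]; ring

/-- **`Φ = Σ_P eJ(P)·deeRep(qc₃P)`** for a junta first family (any twist). [this work] -/
theorem phiPart_liftQ_eq_sum (A B : Set (Set ι)) :
    phiPart τ (liftQ Q 𝔘) A B = ∑ P ∈ cfgsIn Q, eJ τ Q 𝔘 P * deeRep τ Q A B (qc₃ τ Q P) := by
  unfold phiPart eJ
  rw [triT_eq_sum_cfgsIn τ Q (fun _ _ x₃ => x₃ ∈ liftQ Q 𝔘 ∧ x₃ ∈ A ∧ x₃ ∈ B),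
    triT_eq_sum_cfgsIn τ Q (fun x₁ _ x₃ => x₁ ∈ liftQ Q 𝔘 ∧ x₃ ∈ A ∧ x₃ ∈ B)]
  push_cast
  rw [mul_sum, ← sum_sub_distrib]
  refine sum_congr rfl fun P hP => ?_
  rw [mem_cfgsIn] at hP
  have f3 : (triT τ (fun x₁ x₂ x₃ => x₁ ∩ Q = Q \ τ ∧ (x₃ \ Q ∪ qc₃ τ Q P ∈ liftQ Q 𝔘 ∧ x₃ \ Q ∪ qc₃ τ Q P ∈ A ∧ x₃ \ Q ∪ qc₃ τ Q P ∈ B)) : ℤ)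
      = indZ (qc₃ τ Q P ∈ 𝔘) * deeRep τ Q A B (qc₃ τ Q P) := by
    unfold deeRep; rw [← triT_and_const]; exact_mod_cast triT_congr fun a b d => by
      rw [sdiff_union_mem_liftQ_iff 𝔘 (x := d) (qc₃_subset τ Q P)]; tauto
  have f1 : (triT τ (fun x₁ x₂ x₃ => x₁ ∩ Q = Q \ τ ∧ (x₁ \ Q ∪ qc₁ τ Q P ∈ liftQ Q 𝔘 ∧ x₃ \ Q ∪ qc₃ τ Q P ∈ A ∧ x₃ \ Q ∪ qc₃ τ Q P ∈ B)) : ℤ)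
      = indZ (qc₁ τ Q P ∈ 𝔘) * deeRep τ Q A B (qc₃ τ Q P) := by
    unfold deeRep; rw [← triT_and_const]; exact_mod_cast triT_congr fun a b d => by
      rw [sdiff_union_mem_liftQ_iff 𝔘 (x := a) (qc₁_subset (τ := τ) hP.1)]; tauto
  rw [f3, f1]; ring

end JuntaWeights

/-- A **pure diagonal Kleitman certificate** for the junta `liftQ Q 𝔘` at the twist `τ` (only `τ ∩ Q` matters): nonnegative weights `κ` on the subsets of
`Q` separating, on every pair of up-set signatures, the two-copy pattern form from below and the one-copy pattern form from above. [this work] -/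
structure DiagCert (τ Q : Set ι) (𝔘 : Set (Set ι)) (κ : Set ι → ℤ) : Prop where
  /-- `κ ≥ 0` on the subsets of `Q`. -/
  nonneg : ∀ m ∈ subsetsOf Q, 0 ≤ κ m
  /-- (i) the two-copy form is dominated by the diagonal form. -/
  two_le : ∀ 𝔄 𝔅 : Set (Set ι), IsUpperSet 𝔄 → IsUpperSet 𝔅 →
    ∑ P ∈ cfgsIn Q, cJ τ Q 𝔘 P * indZ (qc₂ τ Q P ∈ 𝔄 ∧ qc₃ τ Q P ∈ 𝔅) ≤ ∑ m ∈ subsetsOf Q, κ m * indZ (m ∈ 𝔄 ∧ m ∈ 𝔅)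
  /-- (ii) the diagonal form is dominated by the one-copy form. -/
  le_one : ∀ 𝔄 𝔅 : Set (Set ι), IsUpperSet 𝔄 → IsUpperSet 𝔅 →
    ∑ m ∈ subsetsOf Q, κ m * indZ (m ∈ 𝔄 ∧ m ∈ 𝔅) ≤ ∑ P ∈ cfgsIn Q, eJ τ Q 𝔘 P * indZ (qc₃ τ Q P ∈ 𝔄 ∧ qc₃ τ Q P ∈ 𝔅)

/-- **THE SIGNATURE METHOD (certificate ⇒ positivity)**: a pure diagonal certificate for the junta `liftQ Q 𝔘` at `τ` gives
`0 ≤ threePartNT τ (liftQ Q 𝔘) A B` for ALL up-sets `A, B` of the (arbitrary, finite) ground type. [this work] -/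
theorem threePartNT_liftQ_nonneg_of_cert {τ Q : Set ι} {𝔘 : Set (Set ι)} {κ : Set ι → ℤ} (hc : DiagCert τ Q 𝔘 κ)
    {A B : Set (Set ι)} (hA : IsUpperSet A) (hB : IsUpperSet B) : 0 ≤ threePartNT τ (liftQ Q 𝔘) A B := by
  rw [threePartNT_eq_phiPart_sub_rPart, sub_nonneg, rPart_liftQ_eq_sum, phiPart_liftQ_eq_sum]
  calc ∑ P ∈ cfgsIn Q, cJ τ Q 𝔘 P * teeRep τ Q A B (qc₂ τ Q P) (qc₃ τ Q P)
      = ∑ q : Set ι × Set ι, repInd τ Q q * ∑ P ∈ cfgsIn Q, cJ τ Q 𝔘 P * indZ (tr₂ τ Q q ∪ qc₂ τ Q P ∈ A ∧ tr₃ τ Q q ∪ qc₃ τ Q P ∈ B) := by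
        rw [← sum_cfgsIn_mul_sum]
        exact sum_congr rfl fun P _ => by rw [teeRep_eq_sum]
    _ ≤ ∑ q : Set ι × Set ι, repInd τ Q q * ∑ m ∈ subsetsOf Q, κ m * indZ (tr₂ τ Q q ∪ m ∈ A ∧ tr₃ τ Q q ∪ m ∈ B) :=
        sum_le_sum fun q _ => mul_le_mul_of_nonneg_left
          (hc.two_le _ _ (isUpperSet_sig hA (tr₂ τ Q q)) (isUpperSet_sig hB (tr₃ τ Q q))) (repInd_nonneg τ Q q)
    _ = ∑ m ∈ subsetsOf Q, κ m * teeRep τ Q A B m m := by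
        rw [← sum_subsetsOf_mul_sum]
        exact sum_congr rfl fun m _ => by rw [teeRep_eq_sum]
    _ ≤ ∑ m ∈ subsetsOf Q, κ m * deeRep τ Q A B m :=
        sum_le_sum fun m hm => mul_le_mul_of_nonneg_left (teeRep_le_deeRep τ Q hA hB m) (hc.nonneg m hm)
    _ = ∑ q : Set ι × Set ι, repInd τ Q q * ∑ m ∈ subsetsOf Q, κ m * indZ (tr₃ τ Q q ∪ m ∈ A ∧ tr₃ τ Q q ∪ m ∈ B) := by
        rw [← sum_subsetsOf_mul_sum]
        exact sum_congr rfl fun m _ => by rw [deeRep_eq_sum]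
    _ ≤ ∑ q : Set ι × Set ι, repInd τ Q q * ∑ P ∈ cfgsIn Q, eJ τ Q 𝔘 P * indZ (tr₃ τ Q q ∪ qc₃ τ Q P ∈ A ∧ tr₃ τ Q q ∪ qc₃ τ Q P ∈ B) :=
        sum_le_sum fun q _ => mul_le_mul_of_nonneg_left
          (hc.le_one _ _ (isUpperSet_sig hA (tr₃ τ Q q)) (isUpperSet_sig hB (tr₃ τ Q q))) (repInd_nonneg τ Q q)
    _ = ∑ P ∈ cfgsIn Q, eJ τ Q 𝔘 P * deeRep τ Q A B (qc₃ τ Q P) := by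
        rw [← sum_cfgsIn_mul_sum]
        exact sum_congr rfl fun P _ => by rw [deeRep_eq_sum]

/-- Only `τ ∩ Q` enters the certificate conditions: a certificate at `τ` is a certificate at every `τ'` with `τ' ∩ Q = τ ∩ Q`. [this work] -/
theorem DiagCert.of_inter_eq {τ τ' Q : Set ι} {𝔘 : Set (Set ι)} {κ : Set ι → ℤ} (hc : DiagCert τ Q 𝔘 κ) (h : τ' ∩ Q = τ ∩ Q) :
    DiagCert τ' Q 𝔘 κ := by
  have h1 : ∀ P, qc₁ τ' Q P = qc₁ τ Q P := fun P => by unfold qc₁; rw [h]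
  have h2 : ∀ P, qc₂ τ' Q P = qc₂ τ Q P := fun P => by unfold qc₂; rw [h]
  have h3 : ∀ P, qc₃ τ' Q P = qc₃ τ Q P := fun P => by unfold qc₃; rw [h]
  have hc' : ∀ P, cJ τ' Q 𝔘 P = cJ τ Q 𝔘 P := fun P => by unfold cJ; rw [h1, h2, h3]
  have he' : ∀ P, eJ τ' Q 𝔘 P = eJ τ Q 𝔘 P := fun P => by unfold eJ; rw [h1, h3]
  refine ⟨hc.nonneg, fun 𝔄 𝔅 h𝔄 h𝔅 => ?_, fun 𝔄 𝔅 h𝔄 h𝔅 => ?_⟩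
  · simp only [hc', h2, h3]; exact hc.two_le 𝔄 𝔅 h𝔄 h𝔅
  · simp only [he', h3]; exact hc.le_one 𝔄 𝔅 h𝔄 h𝔅

/-- **The junta theorem from certificates at all twists of the block**: if every `τ₀ ⊆ Q` carries a certificate, then
`threePartNT τ (liftQ Q 𝔘) A B ≥ 0` for every twist and all up-sets. [this work] -/
theorem threePartNT_liftQ_nonneg_of_certs {Q : Set ι} {𝔘 : Set (Set ι)} (κ : Set ι → Set ι → ℤ)
    (hc : ∀ τ₀, τ₀ ⊆ Q → DiagCert τ₀ Q 𝔘 (κ τ₀)) (τ : Set ι) {A B : Set (Set ι)} (hA : IsUpperSet A) (hB : IsUpperSet B) :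
    0 ≤ threePartNT τ (liftQ Q 𝔘) A B :=
  threePartNT_liftQ_nonneg_of_cert ((hc (τ ∩ Q) Set.inter_subset_right).of_inter_eq (by rw [Set.inter_assoc, Set.inter_self])) hA hB

end Summit.CriticalPhenomena.PercolationContinuityZ3.Theorems.ThreePartition

end
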